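import Summits.AtomisticToContinuum.Crystallization.Theorems.ThreeConeCertificateSlackRigidityPricedFloorsGlobalize6

/-!
# Globalisation of exact local layerings, VII: all the layers; no room; translation covariance

Helper file for the stub `stub_globalize` of the line `priced-floors-palm-exactification`
(crux `ThreeConeCertificate.SlackRigidity`, item 11960): the exact local-to-global layer lemma
(Hales, *Dense Sphere Packings* §1.3, layer induction) for the admissible layered family of
item 13958.  This file: iterating the layer step upwards and downwards from the layer through `0` (two `ℕ`-recursions) gives the Hägg sequence and the heights of a full admissible layered set inside `S`; the layered set leaves no room (every point of `ℝ³` is within `9/10` of it), so a configuration containing it equals it and is globally layered; translation covariance.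
-/

noncomputable section

open Set
open Literature.MathematicalPhysics.StatisticalMechanics
open Summit.AtomisticToContinuum.Crystallization.Theorems.SlackRigidityPricedFloors

namespace Summit.AtomisticToContinuum.Crystallization.Theorems.SlackRigidityPricedFloorsGlobalize

variable {a : ℝ}

/-! ## All the layers -/

section Layers

variable {S : Set E3}

/-- Splitting a pattern point into its layer base point and an in-plane lattice vector.
[folklore] -/
theorem pt_eq_base_add (a : ℝ) (s : ℤ → ℤ) (z : ℤ → ℝ) (m i j : ℤ) :
    pt a s z m i j = (lat a (haggLabel s m, haggLabel s m) + z m • e3) + lat a (3 * i, 3 * j) := by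
  rw [pt, add_right_comm, ← lat_add]
  congr 2
  ext <;> simp <;> ring

/-- **All the layers** (Hales, DSP §1.3: iterating "one layer forces the next" upwards and
downwards from the layer through the base point): if `0 ∈ S`, every point of `S` is exactly
layered and the shell of `0` is not a regular cuboctahedron, then `S` contains a full admissible
layered set `A '' stdL a s z` through `0`. [cite: HalesDSP2012, §1.3] -/
theorem exists_stdL_subset (hS : ∀ y ∈ S, ExactLayeredAt S y) (h0 : (0 : E3) ∈ S)
    (hnreg : ¬ ((∀ θ ∈ nbr S 0, -θ ∈ nbr S 0) ∧ ∀ θ ∈ nbr S 0, ∀ θ' ∈ nbr S 0, ‖θ‖ = ‖θ'‖)) :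
    ∃ (A : E3 ≃ₗᵢ[ℝ] E3) (a : ℝ) (s : ℤ → ℤ) (z : ℤ → ℝ), IsAdmissibleLayering a s z ∧ z 0 = 0 ∧
      ∀ m i j : ℤ, A (pt a s z m i j) ∈ S := by
  classical
  obtain ⟨A, a, s, z, hadm, hz0, -, -, hN⟩ := site (hS 0 h0)
  obtain ⟨ha1, ha2, hs, hz⟩ := hadm
  have ha : 47 / 50 ≤ a ∧ a ≤ 1 := ⟨ha1, ha2⟩
  obtain ⟨ht1, ht2, hzp, hzn⟩ := abs_heights_of_adm ⟨ha1, ha2, hs, hz⟩ hz0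
  have hσ₁ : s 0 = 1 ∨ s 0 = -1 := hs 0
  have hσ₂ : -s (-1) = 1 ∨ -s (-1) = -1 := by rcases hs (-1) with h | h <;> omega
  -- layer `0`
  have hH : ∀ c ∈ hexCodes, A (lat a c) ∈ nbr S 0 := fun c hc => by
    rw [hN]; exact ⟨_, lat_mem_shellSet hc, rfl⟩
  have hL0 := layer_const hS h0 hnreg (by linarith : 0 < a) hH
  -- the invariant of a layer and the step
  let Inv : E3 × ℤ × ℝ → Prop := fun st => (st.2.1 = 1 ∨ st.2.1 = -1) ∧
      (39 / 50 * a ≤ |st.2.2| ∧ |st.2.2| ≤ 17 / 20 * a) ∧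
      ∃ (σ₂ : ℤ) (t₂ : ℝ), ∀ i j : ℤ, st.1 + A (lat a (3 * i, 3 * j)) ∈ S ∧
        nbr S (st.1 + A (lat a (3 * i, 3 * j))) = A '' shellSet a st.2.1 st.2.2 σ₂ t₂
  have hstep : ∀ st, Inv st → ∃ st' : E3 × ℤ × ℝ,
      st'.1 = st.1 + A (lat a (st.2.1, st.2.1) + st.2.2 • e3) ∧ 0 < st.2.2 * st'.2.2 ∧ Inv st' := by
    rintro ⟨c, σ, t⟩ ⟨hσ, ht, σ₂, t₂, hlay⟩
    obtain ⟨σ', t', σ₂', t₂', hσ', ht', htt', hlay'⟩ := layer_step hS ha hσ ht hlay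
    exact ⟨(c + A (lat a (σ, σ) + t • e3), σ', t'), rfl, htt', hσ', ht', σ₂', t₂', hlay'⟩
  let next : E3 × ℤ × ℝ → E3 × ℤ × ℝ := fun st =>
    if h : Inv st then Classical.choose (hstep st h) else st
  have next_spec : ∀ st, Inv st → (next st).1 = st.1 + A (lat a (st.2.1, st.2.1) + st.2.2 • e3) ∧
      0 < st.2.2 * (next st).2.2 ∧ Inv (next st) := by
    intro st h
    have e : next st = Classical.choose (hstep st h) := dif_pos h
    rw [e]
    exact Classical.choose_spec (hstep st h)
  have hInv_up : Inv ((0 : E3), s 0, z 1) := ⟨hσ₁, ht1, -s (-1), z (-1), fun i j => by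
    have h := hL0 i j; rw [hN] at h; exact h⟩
  have hInv_dn : Inv ((0 : E3), -s (-1), z (-1)) := ⟨hσ₂, ht2, s 0, z 1, fun i j => by
    have h := hL0 i j; rw [hN, shellSet_comm] at h; exact h⟩
  -- the two sequences of layers
  let sequ : ℕ → E3 × ℤ × ℝ := fun n => Nat.rec ((0 : E3), s 0, z 1) (fun _ st => next st) n
  let seqd : ℕ → E3 × ℤ × ℝ := fun n => Nat.rec ((0 : E3), -s (-1), z (-1)) (fun _ st => next st) n
  have sequ_zero : sequ 0 = ((0 : E3), s 0, z 1) := rfl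
  have seqd_zero : seqd 0 = ((0 : E3), -s (-1), z (-1)) := rfl
  have sequ_succ : ∀ n, sequ (n + 1) = next (sequ n) := fun n => rfl
  have seqd_succ : ∀ n, seqd (n + 1) = next (seqd n) := fun n => rfl
  have hup : ∀ n, Inv (sequ n) ∧ 0 < (sequ n).2.2 := by
    intro n
    induction n with
    | zero => exact ⟨hInv_up, hzp⟩
    | succ n ih =>
      obtain ⟨-, hpos, hinv⟩ := next_spec _ ih.1
      rw [sequ_succ]
      exact ⟨hinv, pos_of_mul_pos_right hpos ih.2.le⟩
  have hdn : ∀ n, Inv (seqd n) ∧ (seqd n).2.2 < 0 := by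
    intro n
    induction n with
    | zero => exact ⟨hInv_dn, hzn⟩
    | succ n ih =>
      obtain ⟨-, hpos, hinv⟩ := next_spec _ ih.1
      rw [seqd_succ]
      exact ⟨hinv, neg_of_mul_pos_right hpos ih.2.le⟩
  -- the Hägg sequence and the heights
  let sq : ℤ → ℤ := fun m => if 0 ≤ m then (sequ m.toNat).2.1 else -(seqd (-m - 1).toNat).2.1
  let Zu : ℕ → ℝ := fun n => ∑ k ∈ Finset.range n, (sequ k).2.2
  let Zd : ℕ → ℝ := fun n => ∑ k ∈ Finset.range n, (seqd k).2.2
  let zq : ℤ → ℝ := fun m => if 0 ≤ m then Zu m.toNat else Zd (-m).toNat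
  have sq_nat : ∀ n : ℕ, sq n = (sequ n).2.1 := fun n => by
    simp only [sq, if_pos (Int.natCast_nonneg n), Int.toNat_natCast]
  have sq_neg : ∀ n : ℕ, sq (-((n : ℤ) + 1)) = -(seqd n).2.1 := fun n => by
    have h1 : ¬ (0 : ℤ) ≤ -((n : ℤ) + 1) := by omega
    have h2 : (-(-((n : ℤ) + 1)) - 1).toNat = n := by simp
    simp only [sq, if_neg h1, h2]
  have zq_nat : ∀ n : ℕ, zq n = Zu n := fun n => by
    simp only [zq, if_pos (Int.natCast_nonneg n), Int.toNat_natCast]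
  have zq_neg : ∀ n : ℕ, zq (-(n : ℤ)) = Zd n := fun n => by
    rcases Nat.eq_zero_or_pos n with rfl | hn
    · simp [zq, Zu, Zd]
    · have h1 : ¬ (0 : ℤ) ≤ -(n : ℤ) := by omega
      simp only [zq, if_neg h1, neg_neg, Int.toNat_natCast]
  have Zu_succ : ∀ n, Zu (n + 1) = Zu n + (sequ n).2.2 := fun n => Finset.sum_range_succ _ _
  have hzq0 : zq 0 = 0 := by simp [zq, Zu]
  have Zd_succ : ∀ n, Zd (n + 1) = Zd n + (seqd n).2.2 := fun n => Finset.sum_range_succ _ _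
  -- the layer base points
  have cu : ∀ n : ℕ, (sequ n).1 = A (lat a (haggLabel sq n, haggLabel sq n) + (zq n) • e3) := by
    intro n
    induction n with
    | zero => simp [sequ_zero, hzq0]
    | succ n ih =>
      rw [sequ_succ, (next_spec _ (hup n).1).1, ih, ← map_add, coded_add, zq_nat, zq_nat, Zu_succ,
        Nat.cast_succ, haggLabel_succ, sq_nat, Prod.mk_add_mk]
  have cd : ∀ n : ℕ, (seqd n).1 =
      A (lat a (haggLabel sq (-(n : ℤ)), haggLabel sq (-(n : ℤ))) + (zq (-(n : ℤ))) • e3) := by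
    intro n
    induction n with
    | zero => simp [seqd_zero, hzq0]
    | succ n ih =>
      have hrec : haggLabel sq (-(n : ℤ)) = haggLabel sq (-((n : ℤ) + 1)) + sq (-((n : ℤ) + 1)) := by
        have := haggLabel_succ sq (-((n : ℤ) + 1))
        rwa [show -((n : ℤ) + 1) + 1 = -(n : ℤ) by ring] at this
      have e1 : haggLabel sq (-((n + 1 : ℕ) : ℤ)) = haggLabel sq (-(n : ℤ)) + (seqd n).2.1 := by
        rw [Nat.cast_succ, hrec, sq_neg]; ring
      have e2 : zq (-((n + 1 : ℕ) : ℤ)) = zq (-(n : ℤ)) + (seqd n).2.2 := by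
        rw [zq_neg, zq_neg, Zd_succ]
      rw [seqd_succ, (next_spec _ (hdn n).1).1, ih, ← map_add, coded_add, e1, e2, Prod.mk_add_mk]
  -- the conclusion
  have hsq : IsHaggSeq sq := by
    intro m
    by_cases hm : 0 ≤ m
    · simp only [sq, if_pos hm]; exact (hup _).1.1
    · simp only [sq, if_neg hm]
      rcases (hdn (-m - 1).toNat).1.1 with h | h <;> rw [h] <;> norm_num
  have hzq : ∀ m : ℤ, 39 / 50 * a ≤ zq (m + 1) - zq m ∧ zq (m + 1) - zq m ≤ 17 / 20 * a := by
    intro m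
    rcases le_or_gt 0 m with hm | hm
    · lift m to ℕ using hm
      have e : zq ((m : ℤ) + 1) - zq m = (sequ m).2.2 := by
        rw [show ((m : ℤ) + 1) = ((m + 1 : ℕ) : ℤ) by push_cast; ring, zq_nat, zq_nat, Zu_succ]; ring
      rw [e]
      have h := (hup m).1.2.1
      rwa [abs_of_pos (hup m).2] at h
    · obtain ⟨n, rfl⟩ : ∃ n : ℕ, m = -((n : ℤ) + 1) := ⟨(-m - 1).toNat, by omega⟩
      have e : zq (-((n : ℤ) + 1) + 1) - zq (-((n : ℤ) + 1)) = -(seqd n).2.2 := by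
        rw [show -((n : ℤ) + 1) + 1 = -(n : ℤ) by ring, show -((n : ℤ) + 1) = -((n + 1 : ℕ) : ℤ) by
          push_cast; ring, zq_neg, zq_neg, Zd_succ]; ring
      rw [e]
      have h := (hdn n).1.2.1
      rwa [abs_of_neg (hdn n).2] at h
  refine ⟨A, a, sq, zq, ⟨ha1, ha2, hsq, hzq⟩, by simp [zq, Zu], fun m i j => ?_⟩
  rw [pt_eq_base_add, map_add]
  rcases le_or_gt 0 m with hm | hm
  · lift m to ℕ using hm
    rw [← cu m]
    obtain ⟨-, -, σ₂, t₂, hlay⟩ := (hup m).1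
    exact (hlay i j).1
  · obtain ⟨n, rfl⟩ : ∃ n : ℕ, m = -(n : ℤ) := ⟨(-m).toNat, by omega⟩
    rw [← cd n]
    obtain ⟨-, -, σ₂, t₂, hlay⟩ := (hdn n).1
    exact (hlay i j).1

end Layers

/-- **Registered sub-goal `globalize_all_layers`** (main statement). [folklore] -/
theorem globalize_all_layers : ∀ (S : Set E3), (∀ y ∈ S, ExactLayeredAt S y) → (0 : E3) ∈ S → ¬ ((∀ θ ∈ nbr S 0, -θ ∈ nbr S 0) ∧ ∀ θ ∈ nbr S 0, ∀ θ' ∈ nbr S 0, ‖θ‖ = ‖θ'‖) → ∃ (A : E3 ≃ₗᵢ[ℝ] E3) (a : ℝ) (s : ℤ → ℤ) (z : ℤ → ℝ), IsAdmissibleLayering a s z ∧ z 0 = 0 ∧ ∀ m i j : ℤ, A (pt a s z m i j) ∈ S :=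
  fun _ hS h0 hnreg => exists_stdL_subset hS h0 hnreg

/-! ## No room for further points -/

section NoRoom

variable {S : Set E3}

/-- Heights are monotone. [folklore] -/
theorem z_mono {s : ℤ → ℤ} {z : ℤ → ℝ} (hadm : IsAdmissibleLayering a s z) {m m' : ℤ}
    (h : m ≤ m') : z m ≤ z m' := by
  obtain ⟨n, rfl⟩ : ∃ n : ℕ, m' = m + n := ⟨(m' - m).toNat, by omega⟩
  have := z_add_natCast_ge hadm m n
  have ha := hadm.1
  nlinarith

/-- **Every height lies in some slab between consecutive layers.** [folklore] -/
theorem exists_slab {s : ℤ → ℤ} {z : ℤ → ℝ} (hadm : IsAdmissibleLayering a s z) (r : ℝ) :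
    ∃ m : ℤ, z m ≤ r ∧ r < z (m + 1) := by
  have ha := hadm.1
  have hc : 0 < 39 / 50 * a := by linarith
  -- an upper bound for the layers below `r`
  obtain ⟨N, hN⟩ := exists_nat_gt ((r - z 0) / (39 / 50 * a))
  have hup : r < z N := by
    have h := z_add_natCast_ge hadm 0 N
    rw [zero_add] at h
    have : (r - z 0) < N * (39 / 50 * a) := by rwa [div_lt_iff₀ hc] at hN
    linarith
  obtain ⟨M, hM⟩ := exists_nat_gt ((z 0 - r) / (39 / 50 * a))
  have hdown : z (-(M : ℤ)) ≤ r := by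
    have h := z_add_natCast_ge hadm (-(M : ℤ)) M
    rw [show -(M : ℤ) + M = 0 by ring] at h
    have : (z 0 - r) < M * (39 / 50 * a) := by rwa [div_lt_iff₀ hc] at hM
    linarith
  obtain ⟨m, hm, hmax⟩ := Int.exists_greatest_of_bdd (P := fun m => z m ≤ r)
    ⟨N, fun m hm => by
      by_contra hcon
      have := z_mono hadm (show (N : ℤ) ≤ m by omega)
      linarith⟩ ⟨_, hdown⟩
  refine ⟨m, hm, ?_⟩
  by_contra hcon
  have := hmax (m + 1) (not_lt.1 hcon)
  omega

/-- Coordinates of a pattern point. [folklore] -/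
theorem pt_apply (a : ℝ) (s : ℤ → ℤ) (z : ℤ → ℝ) (m i j : ℤ) :
    pt a s z m i j 0 = a * (2 * (3 * (i : ℝ) + haggLabel s m) + (3 * (j : ℝ) + haggLabel s m)) / 6 ∧
      pt a s z m i j 1 = a * √3 * (3 * (j : ℝ) + haggLabel s m) / 6 ∧ pt a s z m i j 2 = z m := by
  refine ⟨?_, ?_, ?_⟩ <;> simp [pt, lat, e3]

/-- **The layered set leaves no room** (the analogue of `exists_dist_barlowPos_lt_two`): every
point of `ℝ³` is at distance `< 9/10` from the standard admissible layered set (lateral distance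
`≤ 2a/3` to the triangular lattice of the nearest layer, vertical distance `≤ 17a/40`). [folklore] -/
theorem exists_dist_pt_lt {s : ℤ → ℤ} {z : ℤ → ℝ} (hadm : IsAdmissibleLayering a s z) (y : E3) :
    ∃ m i j : ℤ, dist y (pt a s z m i j) < 9 / 10 := by
  have ha1 := hadm.1
  have ha2 := hadm.2.1
  have hz := hadm.2.2.2
  have ha0 : 0 < a := by linarith
  have hs3 : (√3 : ℝ) ^ 2 = 3 := Real.sq_sqrt (by norm_num)
  have hs3pos : 0 < (√3 : ℝ) := by positivity
  -- the nearest layer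
  obtain ⟨m₀, hm1, hm2⟩ := exists_slab hadm (y 2)
  obtain ⟨m, hvert⟩ : ∃ m : ℤ, (y 2 - z m) ^ 2 ≤ 289 / 1600 * a ^ 2 := by
    have hgap := (hz m₀).2
    rcases le_or_gt (y 2 - z m₀) (z (m₀ + 1) - y 2) with h | h
    · refine ⟨m₀, ?_⟩
      have h1 : 0 ≤ y 2 - z m₀ := by linarith
      have h2 : y 2 - z m₀ ≤ 17 / 40 * a := by linarith
      nlinarith
    · refine ⟨m₀ + 1, ?_⟩
      have h1 : 0 ≤ z (m₀ + 1) - y 2 := by linarith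
      have h2 : z (m₀ + 1) - y 2 ≤ 17 / 40 * a := by linarith
      nlinarith
  -- the nearest lattice point of that layer
  obtain ⟨L, hL⟩ : ∃ L : ℝ, (haggLabel s m : ℝ) = L := ⟨_, rfl⟩
  obtain ⟨g, hg⟩ : ∃ g : ℝ, g = 2 * y 1 / (a * √3) - L / 3 := ⟨_, rfl⟩
  obtain ⟨f, hf⟩ : ∃ f : ℝ, f = y 0 / a - g / 2 - L / 2 := ⟨_, rfl⟩
  have hy1 : y 1 = a * √3 / 2 * (g + L / 3) := by
    rw [hg]; field_simp; ring
  have hy0 : y 0 = a * (f + g / 2 + L / 2) := by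
    rw [hf]; field_simp; ring
  obtain ⟨ia, jb, hab⟩ := Literature.Geometry.DiscreteGeometry.exists_corner_form_le
    (Int.fract_nonneg f) (Int.fract_lt_one f).le (Int.fract_nonneg g) (Int.fract_lt_one g).le
  refine ⟨m, ⌊f⌋ + ia, ⌊g⌋ + jb, ?_⟩
  obtain ⟨F, hF⟩ : ∃ F : ℝ, Int.fract f - ia = F := ⟨_, rfl⟩
  obtain ⟨G, hG⟩ : ∃ G : ℝ, Int.fract g - jb = G := ⟨_, rfl⟩
  rw [hF, hG] at hab
  have hfi : (⌊f⌋ : ℝ) = f - ia - F := by rw [← hF, ← Int.self_sub_floor]; ring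
  have hgj : (⌊g⌋ : ℝ) = g - jb - G := by rw [← hG, ← Int.self_sub_floor]; ring
  obtain ⟨c0, c1, c2⟩ := pt_apply a s z m (⌊f⌋ + ia) (⌊g⌋ + jb)
  rw [hL] at c0 c1
  push_cast at c0 c1
  rw [hfi, hgj] at c0
  rw [hgj] at c1
  have d0 : y 0 - pt a s z m (⌊f⌋ + ia) (⌊g⌋ + jb) 0 = a * (F + G / 2) := by rw [c0, hy0]; ring
  have d1 : y 1 - pt a s z m (⌊f⌋ + ia) (⌊g⌋ + jb) 1 = a * √3 / 2 * G := by rw [c1, hy1]; ring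
  have d2 : y 2 - pt a s z m (⌊f⌋ + ia) (⌊g⌋ + jb) 2 = y 2 - z m := by rw [c2]
  have hsq : dist y (pt a s z m (⌊f⌋ + ia) (⌊g⌋ + jb)) ^ 2 < (9 / 10) ^ 2 := by
    rw [Literature.Geometry.DiscreteGeometry.dist_sq_fin3, d0, d1, d2]
    have hlat : (a * (F + G / 2)) ^ 2 + (a * √3 / 2 * G) ^ 2 = a ^ 2 * (F ^ 2 + F * G + G ^ 2) := by
      linear_combination (a ^ 2 * G ^ 2 / 4) * hs3
    rw [hlat]
    have ha2' : a ^ 2 ≤ 1 := by nlinarith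
    have h1 : a ^ 2 * (F ^ 2 + F * G + G ^ 2) ≤ a ^ 2 * (4 / 9) :=
      mul_le_mul_of_nonneg_left hab (sq_nonneg a)
    linarith
  exact (pow_lt_pow_iff_left₀ dist_nonneg (by norm_num) two_ne_zero).1 hsq

/-- **A configuration containing an admissible layered set equals it**: every point of `S` is
within `9/10` of a pattern point `p ∈ S`, and exactness at `p` (whose pattern has no nonzero
point of norm `≤ 9/10`) forces equality. [cite: HalesDSP2012, §1.3] -/
theorem subset_image_stdL (hS : ∀ y ∈ S, ExactLayeredAt S y) {A : E3 ≃ₗᵢ[ℝ] E3} {s : ℤ → ℤ}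
    {z : ℤ → ℝ} (hadm : IsAdmissibleLayering a s z) (hsub : ∀ m i j : ℤ, A (pt a s z m i j) ∈ S) :
    S ⊆ A '' stdL a s z := by
  intro x hx
  obtain ⟨m, i, j, hd⟩ := exists_dist_pt_lt hadm (A.symm x)
  set p := pt a s z m i j with hp
  have hpS : A p ∈ S := hsub m i j
  have hdist : dist x (A p) < 9 / 10 := by
    rwa [← A.symm.dist_map, A.symm_apply_apply]
  obtain ⟨A', a', s', z', hadm', hz0', hE1', -, -⟩ := site (hS _ hpS)
  have hmem := hE1' x hx (by linarith)
  by_contra hcon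
  have hne : A'.symm (x - A p) ≠ 0 := by
    intro h
    rw [map_eq_zero_iff _ A'.symm.injective, sub_eq_zero] at h
    exact hcon ⟨p, pt_mem_stdL _ _ _ _ _ _, h.symm⟩
  have h9 := norm_gt_of_mem_stdL hadm' hz0' hmem hne
  rw [A'.symm.norm_map, ← dist_eq_norm] at h9
  linarith

/-- **Packaging**: a configuration containing an admissible layered set `A '' stdL a s z` is
globally layered (with translation `0`). [folklore] -/
theorem globalLayered_of_stdL_subset (hS : ∀ y ∈ S, ExactLayeredAt S y) {A : E3 ≃ₗᵢ[ℝ] E3}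
    {s : ℤ → ℤ} {z : ℤ → ℝ} (hadm : IsAdmissibleLayering a s z)
    (hsub : ∀ m i j : ℤ, A (pt a s z m i j) ∈ S) : GlobalLayered S := by
  refine ⟨A.toLinearIsometry, 0, a, s, z, hadm, ?_⟩
  rw [layeredSet_eq_image, LinearIsometryEquiv.coe_toLinearIsometry]
  simp only [add_zero, Set.image_id']
  refine Set.Subset.antisymm (subset_image_stdL hS hadm hsub) ?_
  rintro _ ⟨p, ⟨m, i, j, rfl⟩, rfl⟩
  exact hsub m i j

/-! ## Translation covariance -/

/-- Exact layering is translation covariant. [folklore] -/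
theorem exactLayeredAt_image_sub (y₀ : E3) {y : E3} (h : ExactLayeredAt S y) :
    ExactLayeredAt ((fun x => x - y₀) '' S) (y - y₀) := by
  obtain ⟨A, a, s, z, hadm, hz0, hE1, hE2⟩ := h
  refine ⟨A, a, s, z, hadm, hz0, ?_, fun p hp hn => ⟨y + p, hE2 p hp hn, by abel⟩⟩
  rintro _ ⟨x, hx, rfl⟩ hd
  have := hE1 x hx (by simpa using hd)
  simpa using this

/-- The first shell is translation covariant. [folklore] -/
theorem nbr_image_sub (S : Set E3) (y₀ y : E3) : nbr ((fun x => x - y₀) '' S) (y - y₀) = nbr S y := by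
  ext θ
  simp only [nbr, Set.mem_setOf_eq, Set.mem_image]
  constructor
  · rintro ⟨⟨x, hx, hxe⟩, h1, h2⟩
    refine ⟨?_, h1, h2⟩
    have : x = y + θ := by
      have := congrArg (· + y₀) hxe
      simp only [sub_add_cancel] at this
      rw [this]; abel
    rwa [← this]
  · rintro ⟨h, h1, h2⟩
    exact ⟨⟨y + θ, h, by abel⟩, h1, h2⟩

/-- Global layering is translation covariant. [folklore] -/
theorem globalLayered_of_image_sub {y₀ : E3} (h : GlobalLayered ((fun x => x - y₀) '' S)) :
    GlobalLayered S := by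
  obtain ⟨A, t, a, s, z, hadm, hL⟩ := h
  refine ⟨A, t - y₀, a, s, z, hadm, ?_⟩
  rw [← hL, Set.image_image]
  congr 1
  ext x
  abel_nf

end NoRoom

/-- **Registered sub-goal `globalize_no_room`** (main statement). [folklore] -/
theorem globalize_no_room : ∀ (S : Set E3), (∀ y ∈ S, ExactLayeredAt S y) → ∀ (A : E3 ≃ₗᵢ[ℝ] E3) (a : ℝ) (s : ℤ → ℤ) (z : ℤ → ℝ), IsAdmissibleLayering a s z → (∀ m i j : ℤ, A (pt a s z m i j) ∈ S) → GlobalLayered S :=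
  fun _ hS _ _ _ _ hadm hsub => globalLayered_of_stdL_subset hS hadm hsub

end Summit.AtomisticToContinuum.Crystallization.Theorems.SlackRigidityPricedFloorsGlobalize

end
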